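import Mathlib
import HarnessLib
import Summits.NavierStokesRegularity.NavierStokesRegularity.Theorems.HeredityAtOne.Negative.GermHostZeroMean

/-!
# The level-1 slice of every `slot` witness carries ZERO hydrodynamic impulse (a necessary condition for
# `stub_explicit_slice_run` of the crux `EpisodeBase`, item 19179 — Saffman (3.2.9) from the energy)

Cell `ns-blowup`, seat `ns-blowup-fc-prover-3` (g8; prover, GROUP E re-point; bears_on LADDER-NS N1, route
`PalasekTowerBreakdown`, crux `EpisodeBase` = item stmt-NavierStokesRegularity-19179, registered line `slot` v5
(`Cruxes/EpisodeBase/Lines/slot.lean`, stub `stub_explicit_slice_run : ExplicitSliceRun`) — supports only). LABEL: KERNEL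
bookkeeping (theorems only; no definition, no named fact; nothing asserted about the crux).

THE STUB asks for an explicit germ design `d : Germ.LineGermData U ρ σ₀ ε c₄` and a classical finite-energy solution
`(v, q)` of Navier–Stokes at unit viscosity on the first window `[1, τ₁]` (`τ₁ = Host.τfirst = 1 + w₀`), forced by the
design's own faded residual `lineForce U σ₀ ε`, starting from `v 1 = U`, below `(5/3)Y₁`, showing at `τ₁` the level-1
letter (speed `Y₁`, strain `A₁`, `N₁`-core). THIS FILE (necessary condition, unconditional): **for every such witness whose
`τ₁`-slice has an integrable impulse density, the slice carries ZERO hydrodynamic impulse:**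
`∫ x × curl v(τ₁, x) dx = 0` (`integral_cross_curl_sliceRun_eq_zero`). Reason: the line force has zero spatial mean
at every time (`HeredityAtOneGermZeroMean.integral_lineForce_eq_zero`), the profile `U ∈ C_c^∞` has zero impulse
(`∫ x × curl U = 2∫U = 0`), and Saffman's balance holds for every classical finite-energy forced flow
(`IsClassicalNSSolutionOn.integral_cross_vorticity_sub_eq_of_energy`, this seat). In particular the `τ₁`-slice of a slot
witness is NEVER a single signed vortex ring (`not_signedNoSwirlSlice_sliceRun`): the level-1 letter must be carried by an
impulse-balanced configuration (ring pairs, quadrupolar vorticity, …).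

WHAT THIS IS NOT: not Navier–Stokes evidence and no verdict on item 19179 — a constraint every witness of the registered
stub must satisfy; no flow is constructed.

References: P. G. Saffman, *Vortex Dynamics* (1992) §3.2 (3.2.8), (3.2.9), (3.2.11) [cite: Saffman1992, §3.2];
S. Palasek, arXiv:2605.13827 §3.3–§4 [cite: Palasek2026ElementaryModel, §4].
-/

noncomputable section

namespace Summit.NavierStokesRegularity.EpisodeBaseSliceRunImpulse

open Set MeasureTheory Filter Function InnerProductSpace Metric
open scoped RealInnerProductSpace ContDiff Topology ENNReal
open Literature.Analysis.FluidPDE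
open Summit.NavierStokesRegularity.FluidComputer
open Summit.NavierStokesRegularity.FluidComputer.PalasekTowerClayBridge
open Summit.NavierStokesRegularity.FluidComputer.PalasekTowerClayBridge.Germ
open Summit.NavierStokesRegularity.NavierStokesRegularity
open Summit.NavierStokesRegularity.HeredityAtOneNoSwirlCap
open Summit.NavierStokesRegularity.HeredityAtOneGermZeroMean

variable {U : EuclideanSpace ℝ (Fin 3) → EuclideanSpace ℝ (Fin 3)} {ρ σ₀ ε c₄ : ℝ}
  {v : ℝ → EuclideanSpace ℝ (Fin 3) → EuclideanSpace ℝ (Fin 3)} {q : ℝ → EuclideanSpace ℝ (Fin 3) → ℝ}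

/-- The shifted window: `{t | t + 1 ∈ [1, τ₁]} = [0, w₀]`. [folklore] -/
theorem preimage_add_one_window : (fun t : ℝ => t + 1) ⁻¹' Icc 1 Host.τfirst = Icc 0 Host.wfirst := by
  ext t
  simp only [mem_preimage, mem_Icc, Host.τfirst_eq]
  constructor <;> intro h <;> constructor <;> linarith [h.1, h.2]

/-- **THE LEVEL-1 SLICE OF A `slot` WITNESS HAS ZERO IMPULSE.** For an explicit germ design `d : LineGermData U ρ σ₀ ε c₄`
and every classical solution `(v, q)` of Navier–Stokes (unit viscosity) on `[1, τ₁]` forced by `lineForce U σ₀ ε` with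
`v 1 = U` and finite energy on the window: if `x × curl v(τ₁)` is integrable then `∫ x × curl v(τ₁, x) dx = 0`.
[cite: Saffman1992, §3.2 eqs. (3.2.8), (3.2.9)] [cite: Palasek2026ElementaryModel, §4] -/
theorem integral_cross_curl_sliceRun_eq_zero (d : LineGermData U ρ σ₀ ε c₄)
    (hv : IsClassicalNSSolutionOn (Icc 1 Host.τfirst) 1 (lineForce U σ₀ ε) v q) (h1 : v 1 = U)
    (hEn : ∃ C : ℝ≥0∞, C < ⊤ ∧ ∀ t ∈ Icc (1 : ℝ) Host.τfirst, ∫⁻ x, ‖v t x‖ₑ ^ 2 ≤ C)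
    (hI : Integrable fun x => cross x (curl (v Host.τfirst) x)) :
    ∫ x, cross x (curl (v Host.τfirst) x) = 0 := by
  have hUc : HasCompactSupport U :=
    (isCompact_closedBall (0 : EuclideanSpace ℝ (Fin 3)) ρ).of_isClosed_subset (isClosed_tsupport U) d.support
  have hw0 : 0 < Host.wfirst := Host.wfirst_pos
  -- shift time by `1`
  set w : ℝ → EuclideanSpace ℝ (Fin 3) → EuclideanSpace ℝ (Fin 3) := fun t => v (t + 1) with hwdef
  have hsol : IsClassicalNSSolutionOn (Icc 0 Host.wfirst) 1 (fun t => lineForce U σ₀ ε (t + 1)) w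
      (fun t => q (t + 1)) := by
    have h := hv.comp_add_right 1
    rwa [preimage_add_one_window] at h
  have hmem : ∀ {t : ℝ}, t ∈ Icc 0 Host.wfirst → t + 1 ∈ Icc 1 Host.τfirst := fun ht => by
    rw [Host.τfirst_eq]; exact ⟨by linarith [ht.1], by linarith [ht.2]⟩
  -- energy
  obtain ⟨C, hCt, hC⟩ := hEn
  have h2 : ∀ τ ∈ Icc 0 Host.wfirst, Integrable fun x => ‖w τ x‖ ^ 2 := fun τ hτ =>
    integrable_sq_norm_of_lintegral_lt_top (hsol.contDiff_velocity hτ).continuous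
      ((hC _ (hmem hτ)).trans_lt hCt)
  have hE : ∀ τ ∈ Icc 0 Host.wfirst, ∫ x, ‖w τ x‖ ^ 2 ≤ C.toReal := by
    intro τ hτ
    have e : ∫ x, ‖w τ x‖ ^ 2 = (∫⁻ x, ‖w τ x‖ₑ ^ 2).toReal := by
      rw [integral_eq_lintegral_of_nonneg_ae (Eventually.of_forall fun x => sq_nonneg _)
        (h2 τ hτ).aestronglyMeasurable]
      congr 1
      refine lintegral_congr fun x => ?_
      rw [ENNReal.ofReal_pow (norm_nonneg _), ofReal_norm]
    rw [e]
    exact ENNReal.toReal_mono hCt.ne (hC _ (hmem hτ))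
  -- force majorant: `c₄ Y₀` on the ball of radius `ρ`, zero outside
  set F : EuclideanSpace ℝ (Fin 3) → ℝ := (closedBall (0 : EuclideanSpace ℝ (Fin 3)) ρ).indicator
    fun _ => c₄ * TowerRates.wide.Y 0 with hFdef
  have hF : Integrable F :=
    (integrable_indicator_iff measurableSet_closedBall).2 (integrableOn_const measure_closedBall_lt_top.ne)
  have hfF : ∀ τ ∈ Icc 0 Host.wfirst, ∀ x, ‖lineForce U σ₀ ε (τ + 1) x‖ ≤ F x := by
    intro τ hτ x
    by_cases hx : x ∈ closedBall (0 : EuclideanSpace ℝ (Fin 3)) ρ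
    · rw [hFdef, indicator_of_mem hx]
      exact d.norm_force_le _ (hmem hτ) x
    · have hx' : ρ < ‖x‖ := by rwa [mem_closedBall, dist_zero_right, not_le] at hx
      rw [d.force_eq_zero_of_norm_gt _ x hx', norm_zero, hFdef, indicator_of_notMem hx]
  -- endpoint densities
  have hU1 : ContDiff ℝ 1 U := d.smooth.of_le (by norm_cast)
  have hw0' : w 0 = U := by simp [hwdef, h1]
  have hwT : w Host.wfirst = v Host.τfirst := by simp [hwdef, Host.τfirst_eq, add_comm]
  have hIU : Integrable fun x => cross x (curl U x) := by
    have hc : Continuous fun x => cross x (curl U x) :=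
      crossCLM.continuous₂.comp (continuous_id.prodMk (continuous_curl hU1))
    exact hc.integrable_of_hasCompactSupport (HasCompactSupport.intro hUc fun x hx => by
      show cross x (curl U x) = 0
      rw [curl_eq_zero_of_notMem_tsupport hx, ← crossCLM_apply, map_zero])
  have hI0 : Integrable fun x => cross x (curl (w 0) x) := by rw [hw0']; exact hIU
  have hIT : Integrable fun x => cross x (curl (w Host.wfirst) x) := by rw [hwT]; exact hI
  -- the law on `[0, w₀]`
  have hlaw := hsol.integral_cross_vorticity_sub_eq_of_energy hw0 h2 hE hF hfF le_rfl hw0.le le_rfl hI0 hIT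
  -- the push has zero mean at every time
  have hzero : ∫ τ in (0 : ℝ)..Host.wfirst, ∫ x, lineForce U σ₀ ε (τ + 1) x = 0 := by
    rw [intervalIntegral.integral_of_le hw0.le]
    refine setIntegral_eq_zero_of_forall_eq_zero fun τ hτ => ?_
    exact integral_lineForce_eq_zero d.smooth hUc d.divFree σ₀ ε (by linarith [hτ.1])
  beta_reduce at hlaw
  rw [hzero, smul_zero, hw0', hwT, integral_cross_curl_eq_zero_of_isDivFree hU1 d.divFree
    (d.smooth.continuous.integrable_of_hasCompactSupport hUc) hIU, sub_zero] at hlaw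
  exact hlaw

/-- **Hence the `τ₁`-slice of a `slot` witness is never a single-signed swirl-free field** (such a field carries the
positive axial impulse `½∫ r²(ω_θ/r)` once it is non-zero; here the slice is non-zero by the speed floor `Y₁`):
under the hypotheses of `integral_cross_curl_sliceRun_eq_zero` plus the speed floor `Y₁ ≤ ‖v(τ₁, x₁)‖` at some point,
`¬ SignedNoSwirlSlice (v τ₁) M` for every `M`. [cite: Saffman1992, §3.2 eqs. (3.2.8), (3.2.9)] -/
theorem not_signedNoSwirlSlice_sliceRun (d : LineGermData U ρ σ₀ ε c₄)
    (hv : IsClassicalNSSolutionOn (Icc 1 Host.τfirst) 1 (lineForce U σ₀ ε) v q) (h1 : v 1 = U)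
    (hEn : ∃ C : ℝ≥0∞, C < ⊤ ∧ ∀ t ∈ Icc (1 : ℝ) Host.τfirst, ∫⁻ x, ‖v t x‖ₑ ^ 2 ≤ C)
    (hfloor : ∃ x, TowerRates.wide.Y 1 ≤ ‖v Host.τfirst x‖) (M : ℝ) :
    ¬ SignedNoSwirlSlice (v Host.τfirst) M := by
  intro hsl
  have hτ : Host.τfirst ∈ Icc (1 : ℝ) Host.τfirst :=
    ⟨by rw [Host.τfirst_eq]; linarith [Host.wfirst_pos], le_rfl⟩
  have hv3 : ContDiff ℝ 3 (v Host.τfirst) := (hv.contDiff_velocity hτ).of_le (by norm_cast)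
  have hv1 : ContDiff ℝ 1 (v Host.τfirst) := hv3.of_le (by norm_cast)
  -- the axial impulse density is `r²·(ω_θ/r) ≥ 0`, integrable by the slice structure
  have hdict := hsl.axisym.swirl_curl_eq_cylRadius_sq_mul_angVortQuot hv3
  have hIsw : Integrable fun x => swirl (curl (v Host.τfirst)) x := by rw [hdict]; exact hsl.integrable_sq
  -- zero axial impulse from the vector statement restricted to the third component … obtained directly:
  -- the axial law for `w = v(· + 1)` with integrable `swirl` densities
  have hUc : HasCompactSupport U :=
    (isCompact_closedBall (0 : EuclideanSpace ℝ (Fin 3)) ρ).of_isClosed_subset (isClosed_tsupport U) d.support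
  have hU1 : ContDiff ℝ 1 U := d.smooth.of_le (by norm_cast)
  -- `∫ swirl (curl v(τ₁)) = 0`: the component `i = 2` of the impulse, via the signed slice's own integrability
  have hzero : ∫ x, swirl (curl (v Host.τfirst)) x = 0 := by
    -- positivity would contradict: we show the integral is both `> 0` (signed, non-zero slice) and `= 0`
    -- `= 0`: apply the zero-impulse theorem to the vector density when integrable; otherwise use the axial law
    have hw0 : 0 < Host.wfirst := Host.wfirst_pos
    set w : ℝ → EuclideanSpace ℝ (Fin 3) → EuclideanSpace ℝ (Fin 3) := fun t => v (t + 1) with hwdef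
    have hsol : IsClassicalNSSolutionOn (Icc 0 Host.wfirst) 1 (fun t => lineForce U σ₀ ε (t + 1)) w
        (fun t => q (t + 1)) := by
      have h := hv.comp_add_right 1
      rwa [preimage_add_one_window] at h
    have hmem : ∀ {t : ℝ}, t ∈ Icc 0 Host.wfirst → t + 1 ∈ Icc 1 Host.τfirst := fun ht => by
      rw [Host.τfirst_eq]; exact ⟨by linarith [ht.1], by linarith [ht.2]⟩
    obtain ⟨C, hCt, hC⟩ := hEn
    have h2 : ∀ τ ∈ Icc 0 Host.wfirst, Integrable fun x => ‖w τ x‖ ^ 2 := fun τ hτ =>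
      integrable_sq_norm_of_lintegral_lt_top (hsol.contDiff_velocity hτ).continuous
        ((hC _ (hmem hτ)).trans_lt hCt)
    have hE : ∀ τ ∈ Icc 0 Host.wfirst, ∫ x, ‖w τ x‖ ^ 2 ≤ C.toReal := by
      intro τ hτ
      have e : ∫ x, ‖w τ x‖ ^ 2 = (∫⁻ x, ‖w τ x‖ₑ ^ 2).toReal := by
        rw [integral_eq_lintegral_of_nonneg_ae (Eventually.of_forall fun x => sq_nonneg _)
          (h2 τ hτ).aestronglyMeasurable]
        congr 1
        refine lintegral_congr fun x => ?_
        rw [ENNReal.ofReal_pow (norm_nonneg _), ofReal_norm]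
      rw [e]
      exact ENNReal.toReal_mono hCt.ne (hC _ (hmem hτ))
    set F : EuclideanSpace ℝ (Fin 3) → ℝ := (closedBall (0 : EuclideanSpace ℝ (Fin 3)) ρ).indicator
      fun _ => c₄ * TowerRates.wide.Y 0 with hFdef
    have hF : Integrable F :=
      (integrable_indicator_iff measurableSet_closedBall).2 (integrableOn_const measure_closedBall_lt_top.ne)
    have hfF : ∀ τ ∈ Icc 0 Host.wfirst, ∀ x, ‖lineForce U σ₀ ε (τ + 1) x‖ ≤ F x := by
      intro τ hτ x
      by_cases hx : x ∈ closedBall (0 : EuclideanSpace ℝ (Fin 3)) ρ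
      · rw [hFdef, indicator_of_mem hx]
        exact d.norm_force_le _ (hmem hτ) x
      · have hx' : ρ < ‖x‖ := by rwa [mem_closedBall, dist_zero_right, not_le] at hx
        rw [d.force_eq_zero_of_norm_gt _ x hx', norm_zero, hFdef, indicator_of_notMem hx]
    have hw0' : w 0 = U := by simp [hwdef, h1]
    have hwT : w Host.wfirst = v Host.τfirst := by simp [hwdef, Host.τfirst_eq, add_comm]
    have hIU : Integrable fun x => swirl (curl U) x := by
      have hc : Continuous fun x => swirl (curl U) x := by
        have := continuous_curl hU1
        unfold swirl
        fun_prop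
      exact hc.integrable_of_hasCompactSupport (HasCompactSupport.intro hUc fun x hx => by
        show swirl (curl U) x = 0
        simp [swirl, curl_eq_zero_of_notMem_tsupport hx])
    have hI0 : Integrable fun x => swirl (curl (w 0)) x := by rw [hw0']; exact hIU
    have hIT : Integrable fun x => swirl (curl (w Host.wfirst)) x := by rw [hwT]; exact hIsw
    have hlaw := hsol.integral_swirl_vorticity_sub_eq_of_energy hw0 h2 hE hF hfF le_rfl hw0.le le_rfl hI0 hIT
    have hz : ∫ τ in (0 : ℝ)..Host.wfirst, ∫ x, lineForce U σ₀ ε (τ + 1) x 2 = 0 := by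
      rw [intervalIntegral.integral_of_le hw0.le]
      refine setIntegral_eq_zero_of_forall_eq_zero fun τ hτ => ?_
      have hτ1 : (0 : ℝ) ≤ τ + 1 := by linarith [hτ.1]
      have hfi : Integrable (lineForce U σ₀ ε (τ + 1)) := by
        have hfc : Continuous (lineForce U σ₀ ε (τ + 1)) :=
          ((hsol.isSmoothSpaceTimeOn_force (uniqueDiffOn_Icc hw0)).contDiff_slice
            ⟨hτ.1.le, hτ.2⟩).continuous
        exact hF.mono' hfc.aestronglyMeasurable (Eventually.of_forall (hfF τ ⟨hτ.1.le, hτ.2⟩))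
      have e : (∫ x, lineForce U σ₀ ε (τ + 1) x) 2 = 0 := by
        rw [integral_lineForce_eq_zero d.smooth hUc d.divFree σ₀ ε hτ1]; simp
      rw [integral_apply_fin_three hfi] at e
      exact e
    beta_reduce at hlaw
    rw [hz, mul_zero, hw0', hwT, integral_swirl_curl_eq_zero_of_isDivFree hU1 d.divFree
      (d.smooth.continuous.integrable_of_hasCompactSupport hUc) hIU, sub_zero] at hlaw
    exact hlaw
  -- `> 0`: a non-zero signed swirl-free slice carries positive axial impulse
  have hpos : 0 < ∫ x, cylRadius x ^ 2 * angVortQuot (v Host.τfirst) x := by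
    have hnn : ∀ x, 0 ≤ cylRadius x ^ 2 * angVortQuot (v Host.τfirst) x :=
      fun x => mul_nonneg (sq_nonneg _) (hsl.nonneg x)
    have hcont : Continuous fun x => cylRadius x ^ 2 * angVortQuot (v Host.τfirst) x :=
      (continuous_cylRadius.pow 2).mul (contDiff_angVortQuot (n := 0) (by exact_mod_cast hv3)).continuous
    have hI0 : 0 ≤ ∫ x, cylRadius x ^ 2 * angVortQuot (v Host.τfirst) x := integral_nonneg fun x => hnn x
    rcases hI0.lt_or_eq with hlt | heq
    · exact hlt
    exfalso
    have hae : (fun x => cylRadius x ^ 2 * angVortQuot (v Host.τfirst) x) =ᵐ[volume] 0 :=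
      (integral_eq_zero_iff_of_nonneg (fun x => hnn x) hsl.integrable_sq).1 heq.symm
    have hzero' : (fun x => cylRadius x ^ 2 * angVortQuot (v Host.τfirst) x) = 0 :=
      (hcont.ae_eq_iff_eq volume continuous_const).1 hae
    have hcurl : ∀ x, curl (v Host.τfirst) x = 0 := by
      intro x
      have hx : cylRadius x ^ 2 * angVortQuot (v Host.τfirst) x = 0 := by simpa using congrFun hzero' x
      have hn := norm_curl_eq_cylRadius_mul_abs_angVortQuot hsl.axisym hsl.noSwirl hv3 x
      have h0 : cylRadius x * |angVortQuot (v Host.τfirst) x| = 0 := by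
        rcases mul_eq_zero.1 hx with hr | hη
        · rw [(pow_eq_zero_iff two_ne_zero).1 hr, zero_mul]
        · rw [hη, abs_zero, mul_zero]
      rw [h0] at hn
      exact norm_eq_zero.1 hn
    -- `curl v(τ₁) = 0`, finite energy ⇒ `v(τ₁) = 0` (Biot–Savart), against the floor `Y₁ > 0`
    have hτ' : Host.τfirst ∈ Icc (1 : ℝ) Host.τfirst := hτ
    obtain ⟨C, hCt, hC⟩ := hEn
    have h2τ : Integrable fun x => ‖v Host.τfirst x‖ ^ 2 :=
      integrable_sq_norm_of_lintegral_lt_top hv3.continuous ((hC _ hτ').trans_lt hCt)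
    have hc0 : curl (v Host.τfirst) = 0 := funext hcurl
    have hBS := biotSavart_curl_eq_self_of_integrable_sq (hv3.of_le (by norm_cast)) (hv.divFree _ hτ') h2τ
      (by rw [hc0]; simp)
    rw [hc0, biotSavart_zero] at hBS
    obtain ⟨x₁, hx₁⟩ := hfloor
    have hY : 0 < TowerRates.wide.Y 1 := Real.rpow_pos_of_pos (TowerRates.wide.N_pos 1) _
    rw [← hBS] at hx₁
    simp at hx₁
    linarith
  rw [hdict] at hzero
  linarith

end Summit.NavierStokesRegularity.EpisodeBaseSliceRunImpulse

end
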